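import Summits.BirchSwinnertonDyer.Rank1Residual.X10.MuTransferThreeOfFineRankOneClassFree
import Literature.NumberTheory.EllipticCurves.Wuthrich2014.ShaBoundProofs
import HarnessLib

/-!
# Class X10a′ (good ordinary at `3`, `ρ̄_{E,3}` SURJECTIVE) PER PAIR, FLAG-FREE and CLASS-FREE: Miller's
# `BSD(E,3)` at a pair with `3 ∤ #Ш(E/ℚ)_an` from refereed-in-print named facts plus finite certificates ONLY
# — rank `1`: Kato Thm. 17.4 (3) on the good-ordinary tower + Perrin-Riou–Schneider + the Schneider `3`-adic
# height certificate; rank `0`: Wuthrich 2014 Prop. 21 — NO Yan–Zhu (no flag `YZ26@3-BF-ERL-Ohta`), NO F1, NO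
# `ClassX10` / `¬ Semistable` proof, the Mazur–Tate `σ` and Wuthrich's Lemma 20 DISCHARGED; plus the
# literal-model RECORD shapes (cell `b2b-bsdres`, unit `b2b-bsdres-x10` = X10 / N2 class lead, GEN 41; TOOL —
# theorems only, no definition, no named fact, nothing booked)

HONEST FRAMING (run/shared/lean/b2b/bsd-rank1-residual/, verbatim in every file): the goal of the
cell is to DELETE the COMBINATION-SHAPED residual classes of the Birch–Swinnerton-Dyer formula for
ALL analytic-rank `≤ 1` elliptic curves over `ℚ` — "full BSD formula for every rank `≤ 1` curve in
class `C`" assembled STRICTLY from published theorems — so that the rank-`≤ 1` remainder becomes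
exactly the CONSTRUCTION-SHAPED classes, which are TYPED (missing-input `Prop`s), NOT attempted.
This is not "finishing BSD".  X10a′ = X10 ∧ surj(3) is CLOSED (PUB*) AS A CLASS by Yan–Zhu 2026 Thm. 4.15
with the register flag `YZ26@3-BF-ERL-Ohta` (row D3: 5 437 classes carry the token, 2 937 of them literal
on that flag ALONE; PARTITION-SCOREBOARD v1.23).  THIS FILE books nothing and touches no class statement: it
restates the cell's FLAG-FREE per-pair roads at `p = 3` for a SURJECTIVE mod-`3` image with the binders the
tree has meanwhile discharged, CLASS-FREE (so they apply to semistable and non-semistable curves alike), and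
gives them literal-model record shapes — the per-pair instrument by which a D3 cell can leave the flag.
PARTITION (D-0054): D3 / X10a′ × p = 3 — types-the-object-of; closes NONE.

## What (x10 GEN 41, X10-AUDIT §47; `class-closure/N2/D3-PERPAIR-SPEC-x10g41.md`)

* `divisibility_three_of_kato_of_surj` — `3` good ordinary, `ρ̄_{E,3}` onto: Kato's Thm. 17.4 at the pair
  (`hK`, PUBLISHED named fact `kato_divisibility`, clause (3) under `ρ_{E,3^∞}` onto — supplied by the
  good-ordinary tower `surjective_pow_of_goodOrd_of_surj`, Wuthrich's Lemma 20 as a tree THEOREM) and the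
  period unit at `3` (`h3`, A25) ⟹ the Néron-normalised integral divisibility datum.  x10 GEN 5's
  `X10.bsdp_three_rankOne_surj_of_schneider_of_shaAn_unit` carried `hW20` (Lemma 20 as a named fact), `hMT`
  (σ), an inline `hϖ` and `hX : ClassX10 W 3`; all four are gone here.
* **`bsdp_three_rankOne_surj_of_kato_of_schneider_of_shaAn_unit`** — analytic rank `1`: `hK` + PUBLISHED
  `hS` (A35), `hPR` (F39), `hmodP` (A19), `hGZK` (A18), `h3` (A25) + the Schneider certificate `hSch` + `hunit`
  (`3 ∤ #Ш_an`) ⟹ `BSDp W 3` (engine: GEN 41's `missingUpperBoundAt_three_rankOne_of_divisibility_classFree`).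
* `bsdp_three_rankOne_surj_of_fine_of_schneider_of_shaAn_unit` — the same with Kato 17.4 derived from F1.
* **`bsdp_three_rankZero_surj_of_wuthrich_of_shaAn_unit`** — analytic rank `0` (`L(E,1) ≠ 0`): Wuthrich 2014
  Prop. 21 (`hW`, A6) + GZK ⟹ `BSDp W 3` (x10 GEN 2's `X10.bsdp_three_rankZero_surj_of_shaAn_unit` without
  `ClassX10`; NO Kato, NO certificate beyond `3 ∤ #Ш_an`).
* `MuZeroRoad.bsdp_three_rankOne_surj_of_ainvs_of_kato_of_shaAn_unit`,
  `MuZeroRoad.bsdp_three_rankZero_surj_of_ainvs_of_wuthrich_of_shaAn_unit` — RECORD shapes off the literal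
  integer model (good ordinary at `3` decided in the kernel; `hsurj : Surj W 3` a DISPLAYED census binder —
  the image datum of record; `hr1` / `hL`, `hSch`, `hunit` displayed).

READING (evidence; no count moves): every D3 cell of analytic rank `0` with `3 ∤ #Ш_an` has a FLAG-FREE
per-pair road needing NO certificate beyond the census data; every D3 cell of analytic rank `1` with
`3 ∤ #Ш_an` has one needing ONE certificate — THE canonical cyclotomic `3`-adic height is non-degenerate
(the I1 rider; two-engine `3`-adic heights are routine in the cell: X1@3 8 881/8 882 on record).

References: K. Kato, Astérisque 295 (2004) Thm. 17.4 (3) (p. 273), Thm. 12.5 (4) [Kato2004Asterisque];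
C. Wuthrich, Doc. Math. 19 (2014) Lemma 20 (p. 399), Prop. 21 (p. 400) [Wuthrich2014]; B. Perrin-Riou,
Invent. Math. 89 (1987) §1.4 Cor. 1.8 [PerrinRiou1987]; J. Balakrishnan, J. S. Müller, W. Stein, Math.
Comp. 85 (2016) Thm. 1.7 [BalakrishnanMullerStein2015]; R. Greenberg, V. Vatsal, Invent. Math. 142 (2000)
Rem. 3.4 [GreenbergVatsal2000]; B. Mazur, Invent. Math. 44 (1978) Prop. 6.3 (1), Cor. 4.1 [Mazur1978];
R. L. Miller, LMS J. Comput. Math. 14 (2011) Def. 1.1 [Miller2011LMS].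
-/

set_option autoImplicit false

noncomputable section

open scoped Classical MatrixGroups ModularForm

open CongruenceSubgroup WeierstrassCurve Field Literature.NumberTheory.GaloisRepresentations
  Literature.NumberTheory.GaloisCohomology Literature.NumberTheory.EllipticCurves
  Literature.NumberTheory.EllipticCurves.ModularForms Literature.NumberTheory.EllipticCurves.Rank1Residual
  Literature.NumberTheory.EllipticCurves.Rank1Residual.Typed
  Literature.NumberTheory.EllipticCurves.Wuthrich2014
  Literature.NumberTheory.EllipticCurves.Kato2004 Literature.NumberTheory.EllipticCurves.Kato2004.EulerSystemValues
  Literature.NumberTheory.EllipticCurves.Rank1Residual.X11RankOneCertificates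
  Summit.BirchSwinnertonDyer.BirchSwinnertonDyer.Rank1Residual.IntModel
  Summit.BirchSwinnertonDyer.BirchSwinnertonDyer.Rank1Residual.X11RankOne
  Summit.BirchSwinnertonDyer.BirchSwinnertonDyer.Theorems.Rank1ResidualX1Defs
  Summit.BirchSwinnertonDyer.BirchSwinnertonDyer.Rank1Residual

namespace Summit.BirchSwinnertonDyer.Rank1Residual.X10

section Surj

variable (W : WeierstrassCurve ℚ) [W.IsElliptic] [W.IsGloballyMinimal]

/-- **`3` good ordinary, `ρ̄_{E,3}` SURJECTIVE, any rank: Kato's Thm. 17.4 at the pair ⟹ the Néron-normalised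
INTEGRAL divisibility datum at `(E,3)`** — for every cyclotomic `(κ, γ)`, the newform `f` of level `N_E`, the
period ratio `ϖ` and every dual datum `D`: `X` is `Λ`-torsion and some `g ∈ char_Λ X` has `ι g = ϖ · L_3(f, α)`.
Kato 17.4 clause (3) needs `ρ_{E,3^n}` onto for all `n`, which the good-ordinary tower supplies from `ρ̄_{E,3}`
onto (`surjective_pow_of_goodOrd_of_surj`, Wuthrich's Lemma 20 as a THEOREM of the tree); `E[3]` irreducible
(`hasIrreducibleModPGaloisRep_of_hasSurjectiveModNGaloisRep`) gives `ord₃ ϖ = 0` from the period unit `h3`.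
NO `μ`-certificate, NO F1. [cite: Kato2004Asterisque, Thm. 17.4 (3) (p. 273) and Thm. 12.5 (4) (p. 222)]
[cite: Wuthrich2014, Lemma 20 (p. 399)] [cite: GreenbergVatsal2000, §3 Remark (3.4)] -/
theorem divisibility_three_of_kato_of_surj (h3 : realPeriodRat_eq_unit_mul_plusPeriod_three)
    (hK : ∀ (κ : ZpExtension ℚ 3) (γ : Field.absoluteGaloisGroup ℚ) [NeZero (W.conductorNorm ℤ)]
      (f : CuspForm (Gamma0 (W.conductorNorm ℤ)) 2), kato_divisibility W 3 (κ := κ) (γ := γ) (f := f))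
    (hgood : W.HasGoodReductionAtPrime 3) (hord : ¬ ((3 : ℕ) : ℤ) ∣ W.frobeniusTrace 3) (hsurj : Surj W 3) :
    ∀ (κ : ZpExtension ℚ 3) (γ : Field.absoluteGaloisGroup ℚ),
        κ.IsCyclotomic → κ.IsTopGenerator γ → IsCyclotomicVariable 3 γ →
      ∀ [NeZero (W.conductorNorm ℤ)] (f : CuspForm (Gamma0 (W.conductorNorm ℤ)) 2),
        IsNewformOf W f → ∀ (ϖ : ℚ), (ϖ : ℝ) * W.realPeriodRat = plusPeriod f →
      ∀ (D : W.SelmerDualData κ γ), D.IsTorsion ∧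
        ∃ g ∈ D.charIdeal, iwasawaToPowerSeries 3 g =
          PowerSeries.C (ϖ : ℚ_[3]) * padicLFunction f (unitRoot W 3 : ℚ_[3]) := by
  intro κ γ hκ hγ hγ' _ f hf ϖ hϖeq D
  have hirr : Irr W 3 := hasIrreducibleModPGaloisRep_of_hasSurjectiveModNGaloisRep W 3 hsurj
  have hplus : plusPeriod f ≠ 0 := (IsNewform0.plusPeriod_pos_holds hf.1 hf.coeffField_eq_bot).ne'
  have hϖ0 : ϖ ≠ 0 := by
    rintro rfl
    apply hplus
    rw [← hϖeq]
    simp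
  have hϖv : padicValRat 3 ϖ = 0 := padicValRat_periodRatio_eq_zero_three W h3 hgood hirr f hf ϖ hϖeq
  exact divisibility_of_kato_of_surjective_pow W 3 (hK κ γ f) (by decide) hgood hord
    (surjective_pow_of_goodOrd_of_surj W (by decide) ⟨hgood, hord⟩ hsurj) hκ hγ hγ' hf D ϖ hϖ0 hϖv

/-- **X10a′ ∩ {r = 1} PER PAIR, FLAG-FREE: `3` good ordinary, `ρ̄_{E,3}` onto, analytic rank `1`, at a pair with
`ord₃ #Ш(E/ℚ)_an = 0`: Kato's Thm. 17.4 ∧ the Schneider certificate ⟹ Miller's `BSD(E,3)`.**  Upper half: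
`divisibility_three_of_kato_of_surj` into GEN 41's class-free rank-one engine
(`missingUpperBoundAt_three_rankOne_of_divisibility_classFree`: Perrin-Riou–Schneider `hS`, Perrin-Riou 1987
`hPR`, GZK, THE canonical `3`-adic height from the σ-theorem); lower half vacuous (`hunit`).  Binders: PUBLISHED
`hK` (Kato 17.4), `hS` (A35), `hPR` (F39), `hmodP` (A19), `hGZK` (A18), `h3` (A25); data `hgood`/`hord`/`hsurj`/`hr1`;
certificates `hSch`, `hunit`.  NO Yan–Zhu, NO F1, NO `ClassX10`, NO σ / Lemma-20 binder.  Per pair; nothing booked.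
[cite: Kato2004Asterisque, Thm. 17.4 (3) (p. 273)] [cite: Wuthrich2014, Lemma 20 (p. 399)]
[cite: PerrinRiou1987, §1.4 Cor. 1.8] [cite: BalakrishnanMullerStein2015, Thm. 1.7]
[cite: Miller2011LMS, Def. 1.1 (arXiv:1010.2431 p. 3)] -/
theorem bsdp_three_rankOne_surj_of_kato_of_schneider_of_shaAn_unit
    (hK : ∀ (κ : ZpExtension ℚ 3) (γ : Field.absoluteGaloisGroup ℚ) [NeZero (W.conductorNorm ℤ)]
      (f : CuspForm (Gamma0 (W.conductorNorm ℤ)) 2), kato_divisibility W 3 (κ := κ) (γ := γ) (f := f))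
    (hS : Schneider1985_order_charGenerator_odd) (hPR : perrinRiou_rankOne_leadingTerms_odd)
    (hmodP : nonempty_modularParametrizationData)
    (hGZK : rank_eq_analyticRank_of_analyticRank_le_one)
    (h3 : realPeriodRat_eq_unit_mul_plusPeriod_three)
    (hgood : W.HasGoodReductionAtPrime 3) (hord : ¬ ((3 : ℕ) : ℤ) ∣ W.frobeniusTrace 3) (hsurj : Surj W 3)
    (hr1 : W.analyticRank = 1)
    (hSch : ∀ Dh : PAdicHeightData W 3, Dh.IsCanonical → SchneiderConjecture Dh)
    (hunit : ∃ q : ℚ, shaAn W = (q : ℂ) ∧ padicValRat 3 q = 0) : BSDp W 3 := by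
  refine bsdp_of_missingPPartAt W 3 hGZK hr1.le (missingPPartAt_of_lower_of_upper W 3 ?_
    (missingUpperBoundAt_three_rankOne_of_divisibility_classFree W hS hPR hmodP hGZK hgood hord hr1 hSch
      (divisibility_three_of_kato_of_surj W h3 hK hgood hord hsurj)))
  obtain ⟨q, hq, hv⟩ := hunit
  exact ⟨q, hq, by rw [hv]; exact_mod_cast Nat.zero_le _⟩

/-- **The same with Kato's Thm. 17.4 at the pair DERIVED from F1** (`kato_divisibility_three_of_fine`) — for
a reader who prefers one construction fact to the per-pair theorem; otherwise identical.
[cite: Kato2004Asterisque, Thm. 12.6 (p. 222), Thm. 17.4 (3) (p. 273) and §17.13 (pp. 279–280)] -/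
theorem bsdp_three_rankOne_surj_of_fine_of_schneider_of_shaAn_unit
    (hfine : exists_divisibilityInputs_fineQuotient_zeta)
    (hS : Schneider1985_order_charGenerator_odd) (hPR : perrinRiou_rankOne_leadingTerms_odd)
    (hmodP : nonempty_modularParametrizationData)
    (hGZK : rank_eq_analyticRank_of_analyticRank_le_one)
    (h3 : realPeriodRat_eq_unit_mul_plusPeriod_three)
    (hgood : W.HasGoodReductionAtPrime 3) (hord : ¬ ((3 : ℕ) : ℤ) ∣ W.frobeniusTrace 3) (hsurj : Surj W 3)
    (hr1 : W.analyticRank = 1)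
    (hSch : ∀ Dh : PAdicHeightData W 3, Dh.IsCanonical → SchneiderConjecture Dh)
    (hunit : ∃ q : ℚ, shaAn W = (q : ℂ) ∧ padicValRat 3 q = 0) : BSDp W 3 :=
  bsdp_three_rankOne_surj_of_kato_of_schneider_of_shaAn_unit W (kato_divisibility_three_of_fine hfine W) hS
    hPR hmodP hGZK h3 hgood hord hsurj hr1 hSch hunit

/-- **X10a′ ∩ {r = 0} PER PAIR, FLAG-FREE: `3` good, `ρ̄_{E,3}` onto, `L(E,1) ≠ 0`, at a pair with
`ord₃ #Ш(E/ℚ)_an = 0`: Wuthrich 2014 Prop. 21 (`hW`, A6) and Gross–Zagier–Kolyvagin ⟹ Miller's `BSD(E,3)`** —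
x10 GEN 2's `X10.bsdp_three_rankZero_surj_of_shaAn_unit` without the `ClassX10` wrapper (it used it only for
good reduction at `3`).  NO Kato, NO Yan–Zhu, NO certificate beyond `3 ∤ #Ш_an`.  Per pair; nothing booked.
[cite: Wuthrich2014, Prop. 21 (p. 400)] [cite: Miller2011LMS, Def. 1.1 (arXiv:1010.2431 p. 3)] -/
theorem bsdp_three_rankZero_surj_of_wuthrich_of_shaAn_unit (hW : Wuthrich2014.sha_dvd_analyticSha)
    (hGZK : rank_eq_analyticRank_of_analyticRank_le_one)
    (hgood : W.HasGoodReductionAtPrime 3) (hsurj : Surj W 3) (hL : W.entireLFunction 1 ≠ 0)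
    (hunit : ∃ q : ℚ, shaAn W = (q : ℂ) ∧ padicValRat 3 q = 0) : BSDp W 3 :=
  Wuthrich2014.bsdp_of_L_one_ne_zero_of_padicValRat_shaAn_eq_zero hW hGZK W 3 (by decide) hL
    (WeierstrassCurve.HasGoodReduction.not_hasAdditiveReduction _ hgood) (Or.inr hsurj) hunit

end Surj

/-! ### RECORD shapes off a literal integer model (`hsurj` displayed as the census image datum) -/

namespace MuZeroRoad

/-- **X10a′ ∩ {r = 1} record shape: Kato 17.4 ∧ Schneider certificate ∧ `ord₃ #Ш_an = 0` ⟹ Miller's `BSD(E,3)`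
for a cell given by a literal integer model** — good ordinary `3` READ OFF the model (`3 ∤ Δ`, point count at
`3`; the Frobenius-witness certificates of `goodOrdIrr_three_of_ainvs_of_countPoints` are kept for a uniform
record format, irreducibility being also implied by `hsurj`); displayed: `hkato` (Kato 17.4, uniform shape),
PUBLISHED `hS` `hPR` `hmodP` `hGZK` `h3`, census `hsurj` (image of record: `ρ̄_{E,3}` onto) / `hr1`, certificates
`hSch`, `hunit`.  FLAG-FREE; per pair; nothing booked. [cite: Kato2004Asterisque, Thm. 17.4 (3) (p. 273)]
[cite: Wuthrich2014, Lemma 20 (p. 399)] [cite: PerrinRiou1987, §1.4 Cor. 1.8] [cite: Mazur1978, §6 Prop. 6.3 (1) (p. 153)]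
[cite: Miller2011LMS, Def. 1.1 (arXiv:1010.2431 p. 3)] -/
theorem bsdp_three_rankOne_surj_of_ainvs_of_kato_of_shaAn_unit
    (hkato : ∀ (W : WeierstrassCurve ℚ) [W.IsElliptic] [W.IsGloballyMinimal] (p : ℕ) [Fact p.Prime]
      (κ : ZpExtension ℚ p) (γ : Field.absoluteGaloisGroup ℚ) (N : ℕ) [NeZero N]
      (f : CuspForm (Gamma0 N) 2), kato_divisibility W p (κ := κ) (γ := γ) (f := f))
    (hS : Schneider1985_order_charGenerator_odd) (hPR : perrinRiou_rankOne_leadingTerms_odd)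
    (hmodP : nonempty_modularParametrizationData)
    (hGZK : rank_eq_analyticRank_of_analyticRank_le_one)
    (h3 : realPeriodRat_eq_unit_mul_plusPeriod_three)
    (a1 a2 a3 a4 a6 : ℤ) {W : WeierstrassCurve ℚ} [W.IsElliptic] [W.IsGloballyMinimal]
    (hW : integralModelInt W = ⟨a1, a2, a3, a4, a6⟩)
    (ℓ n n3 : ℕ) [Fact ℓ.Prime]
    (h3Δ : ¬ (3 : ℤ) ∣ discOf [a1, a2, a3, a4, a6])
    (hc3 : countPoints [a1, a2, a3, a4, a6] 3 = n3) (hord3 : ¬ (3 : ℤ) ∣ (3 : ℤ) + 1 - n3)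
    (hℓ2 : ℓ ≠ 2) (hℓ3 : ℓ ≠ 3) (hℓΔ : ¬ (ℓ : ℤ) ∣ discOf [a1, a2, a3, a4, a6])
    (hc : countPoints [a1, a2, a3, a4, a6] ℓ = n)
    (hnoroot : ∀ t : ℕ, t < 3 → ¬ (3 : ℤ) ∣ (t : ℤ) ^ 2 - ((ℓ : ℤ) + 1 - n) * t + ℓ)
    (hsurj : Surj W 3) (hr1 : W.analyticRank = 1)
    (hSch : ∀ Dh : PAdicHeightData W 3, Dh.IsCanonical → SchneiderConjecture Dh)
    (hunit : ∃ q : ℚ, shaAn W = (q : ℂ) ∧ padicValRat 3 q = 0) : BSDp W 3 := by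
  obtain ⟨hgood, hord, -⟩ := goodOrdIrr_three_of_ainvs_of_countPoints a1 a2 a3 a4 a6 hW ℓ n n3 h3Δ hc3
    hord3 hℓ2 hℓ3 hℓΔ hc hnoroot
  exact bsdp_three_rankOne_surj_of_kato_of_schneider_of_shaAn_unit W
    (fun κ γ _ f ↦ hkato W 3 κ γ (W.conductorNorm ℤ) f) hS hPR hmodP hGZK h3 hgood hord hsurj hr1 hSch hunit

/-- **X10a′ ∩ {r = 0} record shape: Wuthrich Prop. 21 ∧ `L(E,1) ≠ 0` ∧ `ord₃ #Ш_an = 0` ⟹ Miller's `BSD(E,3)`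
for a cell given by a literal integer model** (good reduction at `3` from `3 ∤ Δ` via the uniform model
certificates); displayed: PUBLISHED `hW` (A6), `hGZK` (A18), census `hsurj` / `hL`, `hunit`.  FLAG-FREE; no
certificate beyond the census data; per pair; nothing booked. [cite: Wuthrich2014, Prop. 21 (p. 400)]
[cite: Mazur1978, §6 Prop. 6.3 (1) (p. 153)] [cite: Miller2011LMS, Def. 1.1 (arXiv:1010.2431 p. 3)] -/
theorem bsdp_three_rankZero_surj_of_ainvs_of_wuthrich_of_shaAn_unit
    (hWu : Wuthrich2014.sha_dvd_analyticSha) (hGZK : rank_eq_analyticRank_of_analyticRank_le_one)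
    (a1 a2 a3 a4 a6 : ℤ) {W : WeierstrassCurve ℚ} [W.IsElliptic] [W.IsGloballyMinimal]
    (hW : integralModelInt W = ⟨a1, a2, a3, a4, a6⟩)
    (ℓ n n3 : ℕ) [Fact ℓ.Prime]
    (h3Δ : ¬ (3 : ℤ) ∣ discOf [a1, a2, a3, a4, a6])
    (hc3 : countPoints [a1, a2, a3, a4, a6] 3 = n3) (hord3 : ¬ (3 : ℤ) ∣ (3 : ℤ) + 1 - n3)
    (hℓ2 : ℓ ≠ 2) (hℓ3 : ℓ ≠ 3) (hℓΔ : ¬ (ℓ : ℤ) ∣ discOf [a1, a2, a3, a4, a6])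
    (hc : countPoints [a1, a2, a3, a4, a6] ℓ = n)
    (hnoroot : ∀ t : ℕ, t < 3 → ¬ (3 : ℤ) ∣ (t : ℤ) ^ 2 - ((ℓ : ℤ) + 1 - n) * t + ℓ)
    (hsurj : Surj W 3) (hL : W.entireLFunction 1 ≠ 0)
    (hunit : ∃ q : ℚ, shaAn W = (q : ℂ) ∧ padicValRat 3 q = 0) : BSDp W 3 := by
  obtain ⟨hgood, -, -⟩ := goodOrdIrr_three_of_ainvs_of_countPoints a1 a2 a3 a4 a6 hW ℓ n n3 h3Δ hc3
    hord3 hℓ2 hℓ3 hℓΔ hc hnoroot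
  exact bsdp_three_rankZero_surj_of_wuthrich_of_shaAn_unit W hWu hGZK hgood hsurj hL hunit

end MuZeroRoad

end Summit.BirchSwinnertonDyer.Rank1Residual.X10

end
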